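import Mathlib
import Literature.RingTheory.CohomologyAnnihilator.AnnihilationOfCohomology
import Literature.RingTheory.CohomologyAnnihilator.Localization
import Literature.AlgebraicGeometry.Resolution.AffineDomainDimension
import Literature.AlgebraicGeometry.Resolution.RankOneReductionProofs
import Summits.ResolutionOfSingularities.ResolutionOfSingularities.Theorems.HomologicalConductorNoZenoBirthDefs
import Summits.ResolutionOfSingularities.ResolutionOfSingularities.Theorems.HomologicalConductorNoZenoTowerNoetherian
import Summits.ResolutionOfSingularities.ResolutionOfSingularities.Theorems.SyzygyFlatteningHigherRankTerminationEssFiniteType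
import Summits.ResolutionOfSingularities.ResolutionOfSingularities.Theorems.SyzygyFlatteningHigherRankTerminationTowerStageBasic
import Summits.ResolutionOfSingularities.ResolutionOfSingularities.Theorems.HomologicalConductorPersistenceAffineChartEssFiniteType
import Summits.ResolutionOfSingularities.ResolutionOfSingularities.Theorems.HomologicalConductorPersistenceLocalisation
import HarnessLib

/-!
# RADICAL persistence of the cohomology annihilator on the normalised `ca`-chart

Crux `HomologicalConductor.Persistence` (stmt-ResolutionOfSingularities-16484), line `birth`
(reshape 3), chain W4.4b helper **H-c** (`[OURS · L1 w44b]` — replaces the role of no printed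
item; NOT a statement of any manuscript; Iyengar–Takahashi's Theorem 5.4 enters ONLY as the
named-fact hypothesis `singEqVCa_essFiniteType`, never re-proved here).

The registered core stub of the line asks for EXPONENT ONE: `x ∈ ca (nrm (B[ca B / x]))` for a
nonzero `x ∈ ca B`. This file lands the **radical form** (the repaired statement `C′` of the
chain plan, rung S-3 `PersistenceRadical`): some power `x ^ N`, `N ≥ 1`, lies in `ca` of the
normalised chart, GIVEN

* `hVCa : singEqVCa_essFiniteType` — Iyengar–Takahashi, Theorem 5.4: for a localisation `R` of a
  finitely generated algebra over a field, `ca R ⊆ 𝔭 ↔ R_𝔭` is not regular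
  [IyengarTakahashi2014, Thm. 5.4] (a `def … : Prop` of the tree, consumed as a hypothesis);
* `hreg` — "the normalised chart is regular off `V(x)`": every prime not containing `x` has a
  regular localisation (discharged by the chain's helper (R)(c): `(nrm B[ca B/x])[x⁻¹] = B[x⁻¹]`
  is regular because `x ∈ ca B`).

Contents:

* `exists_pow_mem_cohomologyAnnihilator_of_isRegularLocalRing_off` — the GENERAL lemma: for a
  domain `C` essentially of finite type over a field `k` and `x ∈ C` with `C_P` regular for every
  prime `P ∌ x`, some `x ^ N ∈ ca C` (`N ≥ 1`). Proof: `C` is the localisation of its finitely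
  generated subalgebra `k[s₁,…,s_r]` (`Algebra.EssFiniteType.subalgebra/submonoid`), an affine
  domain of some Krull dimension `d` (`exists_ringKrullDim_eq_and_trdeg_eq`); Theorem 5.4 prime
  by prime says every prime `P ⊇ ca C` has `C_P` singular, hence `x ∈ P`; so `x ∈ √(ca C)`
  (`Ideal.radical_eq_sInf`).
* `exists_pow_algebraMap_mem_cohomologyAnnihilator_atPrime` — the same at any prime `Q`:
  `(x/1) ^ N ∈ ca (C_Q)` [IyengarTakahashi2014, Lemma 2.10 (1)] (landed
  `algebraMap_mem_cohomologyAnnihilator_of_isLocalization`).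
* `radicalPersistence` — the chain's typed binder `H_c_radicalPersistence` over the route
  vocabulary `NoZeno.Birth.{ca, nrm}` (the idle binders `IsLocalRing ↥B`, `x ≠ 0` of the plan
  signature are dropped: they are not used): `∃ N ≥ 1, x ^ N ∈ ca (nrm (B[ca B / x]))`.
* `radicalPersistence_image` — the same over the line skeleton's vocabulary (images of the
  Literature ideal `cohomologyAnnihilator`).
* `radicalPersistence_locAt` — the LOCAL form at the centre of a valuation ring `O ⊇ B[ca B/x]`:
  `x ^ N ∈ ca (loc O (nrm (B[ca B / x])))` (landed localisation persistence), i.e. the radical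
  version of the proposed local re-cut R1 of the core stub.

References: S. B. Iyengar, R. Takahashi, *Annihilation of cohomology and strong generation of
module categories*, IMRN 2016 [`IyengarTakahashi2014`].
-/

-- single-problem summit: the doubled namespace component `ResolutionOfSingularities` is forced
set_option linter.dupNamespace false

noncomputable section

namespace Summit.ResolutionOfSingularities.ResolutionOfSingularities.Theorems.HomologicalConductor.PersistenceRadical

open Literature.RingTheory.CohomologyAnnihilator (cohomologyAnnihilator singEqVCa_essFiniteType
  ca_eq_cohomologyAnnihilator algebraMap_mem_cohomologyAnnihilator_of_isLocalization)
open Literature.AlgebraicGeometry.Resolution (exists_ringKrullDim_eq_and_trdeg_eq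
  isFractionRing_subalgebra_of_le)
open Summit.ResolutionOfSingularities.ResolutionOfSingularities.Theorems.NoZeno.Birth
  (ca nrm loc ca_subset tn_coe_mem_ca_iff loc_eq_locAt)
open Summit.ResolutionOfSingularities.ResolutionOfSingularities.Theorems.SyzygyFlattening
  (self_le_nrm nrm_toSubring_le self_le_locAt adjoin_toSubring_le_valuationSubring
    stub_essFiniteType_nrm stub_essFiniteType_locAt)
open Summit.ResolutionOfSingularities.ResolutionOfSingularities.Theorems.HomologicalConductor.PersistenceAffineChartEssFiniteType
  (stub_affineChartEssFiniteType)
open Summit.ResolutionOfSingularities.ResolutionOfSingularities.Theorems.HomologicalConductor.PersistenceLocalisation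
  (stub_localisationPersistence)

/-! ## The general lemma: regular off `V(x)` ⇒ `x ∈ √ca` (given Theorem 5.4) -/

/-- **Regular off `V(x)` forces `x` into the radical of the cohomology annihilator** (given
Iyengar–Takahashi's Theorem 5.4 as the hypothesis `hVCa`). Let `C` be a domain essentially of
finite type over a field `k` and `x ∈ C` such that `C_P` is a regular local ring for every prime
`P` with `x ∉ P`. Then `x ^ N ∈ ca C` for some `N ≥ 1`. Indeed `C` is a localisation of its
finitely generated subalgebra `k[s₁, …, s_r]` (an affine domain, of some Krull dimension `d`), so
Theorem 5.4 applies prime by prime: a prime `P ⊇ ca C` has `C_P` singular, hence `x ∈ P`;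
thus `x` lies in every prime over `ca C`, i.e. in `√(ca C)`.
[cite: IyengarTakahashi2014, Thm. 5.4] -/
theorem exists_pow_mem_cohomologyAnnihilator_of_isRegularLocalRing_off
    (hVCa : singEqVCa_essFiniteType.{0}) (k : Type) [Field k] (C : Type) [CommRing C] [IsDomain C]
    [Algebra k C] [Algebra.EssFiniteType k C] (x : C)
    (hreg : ∀ (P : Ideal C) [P.IsPrime], x ∉ P → IsRegularLocalRing (Localization.AtPrime P)) :
    ∃ N : ℕ, 1 ≤ N ∧ x ^ N ∈ cohomologyAnnihilator C := by
  -- the finitely generated model `k[s₁, …, s_r] ⊆ C` of which `C` is a localisation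
  obtain ⟨d, hd, -⟩ := exists_ringKrullDim_eq_and_trdeg_eq k
    ↥(Algebra.EssFiniteType.subalgebra k C)
  have hrad : x ∈ (cohomologyAnnihilator C).radical := by
    rw [Ideal.radical_eq_sInf, Submodule.mem_sInf]
    rintro P ⟨hP, hPprime⟩
    haveI := hPprime
    -- Theorem 5.4 at the prime `P` of the localisation `C`
    have key : Literature.RingTheory.CohomologyAnnihilator.ca C ≤ P ↔
        ¬ IsRegularLocalRing (Localization.AtPrime P) :=
      (hVCa k ↥(Algebra.EssFiniteType.subalgebra k C) inferInstance d hd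
        (Algebra.EssFiniteType.submonoid k C) C inferInstance P).1
    rw [ca_eq_cohomologyAnnihilator] at key
    by_contra hxP
    exact key.mp hP (hreg P hxP)
  obtain ⟨n, hn⟩ := Ideal.mem_radical_iff.mp hrad
  refine ⟨n + 1, Nat.succ_le_succ (Nat.zero_le n), ?_⟩
  rw [pow_succ]
  exact Ideal.mul_mem_right _ _ hn

/-- **The same at any prime `Q` of `C`**: under the hypotheses of
`exists_pow_mem_cohomologyAnnihilator_of_isRegularLocalRing_off`, `(x/1) ^ N ∈ ca (C_Q)` for some
`N ≥ 1` — the annihilator ideal extends into the annihilator ideal of every localisation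
(Lemma 2.10 (1), landed `algebraMap_mem_cohomologyAnnihilator_of_isLocalization`; `C` is
noetherian as it is essentially of finite type over a field).
[cite: IyengarTakahashi2014, Lemma 2.10 (1)] -/
theorem exists_pow_algebraMap_mem_cohomologyAnnihilator_atPrime
    (hVCa : singEqVCa_essFiniteType.{0}) (k : Type) [Field k] (C : Type) [CommRing C] [IsDomain C]
    [Algebra k C] [Algebra.EssFiniteType k C] (x : C)
    (hreg : ∀ (P : Ideal C) [P.IsPrime], x ∉ P → IsRegularLocalRing (Localization.AtPrime P))
    (Q : Ideal C) [Q.IsPrime] :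
    ∃ N : ℕ, 1 ≤ N ∧ (algebraMap C (Localization.AtPrime Q) x) ^ N ∈
      cohomologyAnnihilator (Localization.AtPrime Q) := by
  obtain ⟨N, hN, hxN⟩ :=
    exists_pow_mem_cohomologyAnnihilator_of_isRegularLocalRing_off hVCa k C x hreg
  haveI : IsNoetherianRing C := Algebra.EssFiniteType.isNoetherianRing k C
  refine ⟨N, hN, ?_⟩
  rw [← map_pow]
  exact algebraMap_mem_cohomologyAnnihilator_of_isLocalization Q.primeCompl
    (Localization.AtPrime Q) hxN

/-! ## The chain binder H-c over the route vocabulary `NoZeno.Birth.{ca, nrm, loc}` -/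

variable {k K : Type} [Field k] [Field K] [Algebra k K]

/-- The route's `ca B ⊆ K` is the image of the Literature ideal `cohomologyAnnihilator ↥B`
(`Subalgebra.image_coe_cohomologyAnnihilator`). [cite: IyengarTakahashi2014, Definition 2.1] -/
theorem ca_eq_image (B : Subalgebra k K) :
    ca B = ((↑) : ↥B → K) '' (cohomologyAnnihilator ↥B : Set ↥B) :=
  (Subalgebra.image_coe_cohomologyAnnihilator B).symm

/-- The affine chart `B[ca B / x] = k[B ∪ {c * x⁻¹ | c ∈ ca B}]` contains `B`. [folklore] -/
theorem le_affChart (B : Subalgebra k K) (x : K) :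
    B ≤ Algebra.adjoin k ((B : Set K) ∪ {y : K | ∃ c ∈ ca B, y = c * x⁻¹}) :=
  fun _ hb => Algebra.subset_adjoin (Or.inl hb)

/-- The affine chart `B[ca B / x]` is essentially of finite type over `k` when `B` is (landed
`stub_affineChartEssFiniteType`, transported along `ca_eq_image`). [folklore] -/
theorem essFiniteType_affChart (B : Subalgebra k K) (x : K) (hBft : Algebra.EssFiniteType k ↥B) :
    Algebra.EssFiniteType k ↥(Algebra.adjoin k ((B : Set K) ∪ {y : K | ∃ c ∈ ca B, y = c * x⁻¹})) := by
  rw [ca_eq_image]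
  exact stub_affineChartEssFiniteType k K B x hBft

/-- The normalised affine chart `nrm (B[ca B / x])` is essentially of finite type over `k` when
`B` is and `Frac B = K` (E. Noether's finiteness of the integral closure, tree
`stub_essFiniteType_nrm`). [folklore] -/
theorem essFiniteType_nrm_affChart (B : Subalgebra k K) (x : K) (hBft : Algebra.EssFiniteType k ↥B)
    (hBfrac : IsFractionRing ↥B K) :
    Algebra.EssFiniteType k
      ↥(nrm (Algebra.adjoin k ((B : Set K) ∪ {y : K | ∃ c ∈ ca B, y = c * x⁻¹}))) := by
  haveI := hBfrac
  exact stub_essFiniteType_nrm k K _ (isFractionRing_subalgebra_of_le B _ (le_affChart B x))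
    (essFiniteType_affChart B x hBft)

/-- Any `x ∈ ca B` lies in the normalised affine chart `nrm (B[ca B / x])`
(`ca B ⊆ B ⊆ B[ca B/x] ⊆ nrm (B[ca B/x])`). [folklore] -/
theorem mem_nrm_affChart (B : Subalgebra k K) {x : K} (hx : x ∈ ca B) :
    x ∈ nrm (Algebra.adjoin k ((B : Set K) ∪ {y : K | ∃ c ∈ ca B, y = c * x⁻¹})) :=
  self_le_nrm _ (le_affChart B x (ca_subset B hx))

/-- **H-c — RADICAL persistence on the normalised `ca`-chart (chain W4.4b binder
`H_c_radicalPersistence`; `[OURS · L1 w44b]`).** For `B ⊆ K` essentially of finite type over `k`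
with `Frac B = K`, and `x ∈ ca B`: GIVEN Iyengar–Takahashi's Theorem 5.4 (`hVCa`) and that
every prime of the normalised chart `C = nrm (B[ca B / x])` not containing `x` has a regular
localisation (`hreg`, the chain's helper (R)(c)), some power `x ^ N`, `N ≥ 1`, lies in `ca C`.
This is the repaired statement `C′` (exponent `N` instead of exponent one) of the registered core
stub `stub_normalisedChartPersistence`; it follows from the general lemma
`exists_pow_mem_cohomologyAnnihilator_of_isRegularLocalRing_off` since `C` is a domain
essentially of finite type over `k`. (The plan signature's binders `IsLocalRing ↥B` and `x ≠ 0` are not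
needed and are omitted: for `x = 0` the statement is `0 ∈ ca`.) [cite: IyengarTakahashi2014, Thm. 5.4] -/
theorem radicalPersistence (hVCa : singEqVCa_essFiniteType.{0}) (B : Subalgebra k K) (x : K)
    (hBft : Algebra.EssFiniteType k ↥B) (hBfrac : IsFractionRing ↥B K)
    (hx : x ∈ ca B)
    (hreg : ∀ (P : Ideal ↥(nrm (Algebra.adjoin k ((B : Set K) ∪
        {y : K | ∃ c ∈ ca B, y = c * x⁻¹})))) [P.IsPrime],
      (∀ c : ↥(nrm (Algebra.adjoin k ((B : Set K) ∪ {y : K | ∃ c ∈ ca B, y = c * x⁻¹}))),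
        (c : K) = x → c ∉ P) →
        IsRegularLocalRing (Localization.AtPrime P)) :
    ∃ N : ℕ, 1 ≤ N ∧ x ^ N ∈ ca (nrm (Algebra.adjoin k ((B : Set K) ∪
      {y : K | ∃ c ∈ ca B, y = c * x⁻¹}))) := by
  haveI := essFiniteType_nrm_affChart B x hBft hBfrac
  set C := nrm (Algebra.adjoin k ((B : Set K) ∪ {y : K | ∃ c ∈ ca B, y = c * x⁻¹}))
  have hxC : x ∈ C := mem_nrm_affChart B hx
  have hreg' : ∀ (P : Ideal ↥C) [P.IsPrime], (⟨x, hxC⟩ : ↥C) ∉ P →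
      IsRegularLocalRing (Localization.AtPrime P) := by
    intro P _ hxP
    refine hreg P fun c hc hcP => hxP ?_
    have hcx : c = ⟨x, hxC⟩ := Subtype.ext hc
    rw [← hcx]
    exact hcP
  obtain ⟨N, hN, hxN⟩ :=
    exists_pow_mem_cohomologyAnnihilator_of_isRegularLocalRing_off hVCa k ↥C ⟨x, hxC⟩ hreg'
  refine ⟨N, hN, ?_⟩
  have hcoe : (((⟨x, hxC⟩ : ↥C) ^ N : ↥C) : K) = x ^ N := by
    simp
  rw [← hcoe]
  exact (tn_coe_mem_ca_iff C _).mpr hxN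

/-- **H-c over the line skeleton's vocabulary** (images of the Literature ideal, as in the
registered stub `stub_normalisedChartPersistence` of `Cruxes/Persistence/Lines/birth.lean`):
same statement with `ca B` spelled `(↑) '' cohomologyAnnihilator ↥B`.
[cite: IyengarTakahashi2014, Thm. 5.4] -/
theorem radicalPersistence_image (hVCa : singEqVCa_essFiniteType.{0}) (B : Subalgebra k K) (x : K)
    (hBft : Algebra.EssFiniteType k ↥B) (hBfrac : IsFractionRing ↥B K)
    (hx : x ∈ ((↑) : ↥B → K) '' (cohomologyAnnihilator ↥B : Set ↥B))
    (hreg : ∀ (P : Ideal ↥(nrm (Algebra.adjoin k ((B : Set K) ∪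
        {y : K | ∃ c ∈ ((↑) : ↥B → K) '' (cohomologyAnnihilator ↥B : Set ↥B),
          y = c * x⁻¹})))) [P.IsPrime],
      (∀ c : ↥(nrm (Algebra.adjoin k ((B : Set K) ∪
          {y : K | ∃ c ∈ ((↑) : ↥B → K) '' (cohomologyAnnihilator ↥B : Set ↥B), y = c * x⁻¹}))),
        (c : K) = x → c ∉ P) →
        IsRegularLocalRing (Localization.AtPrime P)) :
    ∃ N : ℕ, 1 ≤ N ∧ x ^ N ∈
      ((↑) : ↥(nrm (Algebra.adjoin k ((B : Set K) ∪
          {y : K | ∃ c ∈ ((↑) : ↥B → K) '' (cohomologyAnnihilator ↥B : Set ↥B), y = c * x⁻¹}))) →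
        K) ''
        (cohomologyAnnihilator ↥(nrm (Algebra.adjoin k ((B : Set K) ∪
          {y : K | ∃ c ∈ ((↑) : ↥B → K) '' (cohomologyAnnihilator ↥B : Set ↥B),
            y = c * x⁻¹}))) : Set _) := by
  rw [← ca_eq_image] at hx hreg ⊢
  rw [← ca_eq_image]
  exact radicalPersistence hVCa B x hBft hBfrac hx hreg

/-- **Localisation at the centre preserves `ca`** (route vocabulary): for a noetherian
`C ⊆ O`, `ca C ⊆ ca (loc O C)` — the landed localisation persistence
`stub_localisationPersistence` (`loc O C` is the localisation of `C` at the centre of `O`).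
[cite: IyengarTakahashi2014, Lemma 2.10 (1)] -/
theorem ca_subset_ca_loc (O : ValuationSubring K) (C : Subalgebra k K)
    (hCO : C.toSubring ≤ O.toSubring) (hC : IsNoetherianRing ↥C) : ca C ⊆ ca (loc O C) := by
  rw [ca_eq_image, ca_eq_image, loc_eq_locAt]
  exact stub_localisationPersistence k K O C hCO hC

/-- For `B ⊆ O` and `x` with `c * x⁻¹ ∈ O` for all `c ∈ ca B` (e.g. `x ∈ ca B` of minimal
`O`-value), the normalised affine chart `nrm (B[ca B / x])` lies in `O`. [folklore] -/
theorem nrm_affChart_toSubring_le (O : ValuationSubring K) (B : Subalgebra k K) {x : K}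
    (hBO : B.toSubring ≤ O.toSubring) (hmin : ∀ c ∈ ca B, c * x⁻¹ ∈ O) :
    (nrm (Algebra.adjoin k ((B : Set K) ∪ {y : K | ∃ c ∈ ca B, y = c * x⁻¹}))).toSubring ≤
      O.toSubring := by
  have hk : ∀ c : k, algebraMap k K c ∈ O := fun c => hBO (B.algebraMap_mem c)
  refine nrm_toSubring_le O hk (adjoin_toSubring_le_valuationSubring O hk ?_)
  rintro y (hy | ⟨c, hc, rfl⟩)
  · exact hBO (Subalgebra.mem_toSubring.mpr hy)
  · exact hmin c hc

/-- **H-c, LOCAL form at the centre of a valuation ring** (the radical version of the proposed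
local re-cut R1 of the core stub; rung S-3 `PersistenceRadical` of the chain plan, one step).
For `B ⊆ O` essentially of finite type with `Frac B = K`, `x ∈ ca B` with `c * x⁻¹ ∈ O` for
all `c ∈ ca B`: GIVEN Theorem 5.4 (`hVCa`) and regularity of the normalised chart off `V(x)`
(`hreg`), some `x ^ N`, `N ≥ 1`, lies in `ca (loc O (nrm (B[ca B / x])))` — by
`radicalPersistence` and the landed localisation persistence `ca C ⊆ ca (loc O C)` for
noetherian `C ⊆ O` [IyengarTakahashi2014, Lemma 2.10 (1)].
[cite: IyengarTakahashi2014, Thm. 5.4] -/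
theorem radicalPersistence_locAt (hVCa : singEqVCa_essFiniteType.{0}) (O : ValuationSubring K)
    (B : Subalgebra k K) (x : K)
    (hBft : Algebra.EssFiniteType k ↥B) (hBfrac : IsFractionRing ↥B K)
    (hBO : B.toSubring ≤ O.toSubring)
    (hx : x ∈ ca B) (hmin : ∀ c ∈ ca B, c * x⁻¹ ∈ O)
    (hreg : ∀ (P : Ideal ↥(nrm (Algebra.adjoin k ((B : Set K) ∪
        {y : K | ∃ c ∈ ca B, y = c * x⁻¹})))) [P.IsPrime],
      (∀ c : ↥(nrm (Algebra.adjoin k ((B : Set K) ∪ {y : K | ∃ c ∈ ca B, y = c * x⁻¹}))),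
        (c : K) = x → c ∉ P) →
        IsRegularLocalRing (Localization.AtPrime P)) :
    ∃ N : ℕ, 1 ≤ N ∧ x ^ N ∈ ca (loc O (nrm (Algebra.adjoin k ((B : Set K) ∪
      {y : K | ∃ c ∈ ca B, y = c * x⁻¹})))) := by
  obtain ⟨N, hN, hxN⟩ := radicalPersistence hVCa B x hBft hBfrac hx hreg
  haveI := essFiniteType_nrm_affChart B x hBft hBfrac
  have hNnoeth : IsNoetherianRing
      ↥(nrm (Algebra.adjoin k ((B : Set K) ∪ {y : K | ∃ c ∈ ca B, y = c * x⁻¹}))) :=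
    Algebra.EssFiniteType.isNoetherianRing k _
  exact ⟨N, hN, ca_subset_ca_loc O _ (nrm_affChart_toSubring_le O B hBO hmin) hNnoeth hxN⟩

end Summit.ResolutionOfSingularities.ResolutionOfSingularities.Theorems.HomologicalConductor.PersistenceRadical

end
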